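import Summits.BirchSwinnertonDyer.BirchSwinnertonDyer.Theses.ResidualThetaTransportAtTwo
import Summits.BirchSwinnertonDyer.BirchSwinnertonDyer.Theorems.ThetaPartnerAtTwoSignedTransportAtTwoRankZeroOfPoitouTate
import HarnessLib

/-!
# RLF `ResidualLambdaFormulaNegDiscAtTwo` (stmt-BirchSwinnertonDyer-23110, routes `ResidualThetaTransportAtTwo` r201 /
# `ThetaPartnerAtTwo`) RESTRICTED TO ANALYTIC RANK `0`, from the FOUR generic Poitou–Tate facts over `ℚ` + GZK — the PT-keyed twin of
# rtt-p2's `residualLambdaFormulaNegDiscAtTwo_rankZero_of_pub` (p606111; seat `bsd-inputs-r1-p1`, `--supports`; closes nothing)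

THEOREMS ONLY; no definition; BSD is not proved by any of this. p606111 certified: PUB-G (conjuncts 1, 2, 3, 5 of
`PublishedInputsGreenbergControlAtTwo`, 24143) → GZK → ⟨23110's text with `E.analyticRank = 0 →` inserted after `E.Δ < 0 →`⟩, through
`SignedTransportAtTwo.rlf2_of_print4`. With the K1P re-pointing (`…SignedTransportAtTwoRankZeroOfPoitouTate`:
`SignedTransportAtTwo.rlf2_of_cassels_of_shaTwo`) the same restatement follows from the K4 v12 residue instead:

* `residualLambdaFormulaNegDiscAtTwo_rankZero_of_poitouTate_four` : `poitouTate_selmerStructure_duality ℚ → poitouTate_sha_tateDual ℚ →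
  poitouTate_three_realPlaces_injective ℚ → poitouTate_two_realPlaces_surjective ℚ → RankEqAnalyticRankLeOne →` ⟨23110's text with
  `E.analyticRank = 0 →` inserted after `E.Δ < 0 →`, VERBATIM p606111's⟩ (witness `c = 0`); CASSELS := PT(b)
  (`SignedEC.CasselsPT.casselsSurjectivity_H1Sigma_of_poitouTate`, w3), `Ш²(ℚ, E[2^∞]) = 0` := PT(a) + Milne I 4.10(c)₃ + Cor. 4.16 under
  `Sel_{2^∞}(E/ℚ)` finite (`SignedEC.ShaTwo.stub_shaTwoPrimaryVanishing_of_poitouTate`, w2), the finiteness from GZK at analytic rank `0`.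

No Greenberg 1999 Prop. 4.12 / 4.13, no corank count, no weak Leopoldt (Kato 12.4) remain on this road; the four PT facts are named facts
taken as hypotheses (`conditional-result`). References: [MilneADT2006] I Thm. 4.10, Cor. 4.16; [GreenbergVatsal2000] §2 Prop. (2.1), (2.4),
(10); [BDKim2013] Thm. 1.1; [Kolyvagin1990] Thm. A; [GrossZagier1986] Thm. I.6.3.
-/

set_option autoImplicit false
-- D-0017: single-problem summit, so `Summit.BirchSwinnertonDyer.BirchSwinnertonDyer.…` repeats a namespace BY DESIGN.
set_option linter.dupNamespace false

noncomputable section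

open scoped Classical

open Literature.NumberTheory.EllipticCurves Literature.NumberTheory.GaloisCohomology

namespace Summit.BirchSwinnertonDyer.BirchSwinnertonDyer.Theorems.ResidualThetaLayer

/-- **23110 at analytic rank `0`, from the four generic Poitou–Tate facts over `ℚ`.** Text = route decl `ResidualLambdaFormulaNegDiscAtTwo`
with the single binder `E.analyticRank = 0 →` inserted after `E.Δ < 0 →` (verbatim p606111's restatement); proved with the uniform
constant `c = 0` from `SignedTransportAtTwo.rlf2_of_cassels_of_shaTwo`, CASSELS from PT(b), `Ш²(ℚ, E[2^∞]) = 0` from PT(a) + 4.10(c)₃ +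
Cor. 4.16 under `Sel_{2^∞}(E/ℚ)` finite, and the finiteness from GZK (`finite_selmerGroupPInfty_two_of_analyticRank_eq_zero`).
[cite: MilneADT2006, Ch. I, Thm. 4.10 (a),(b),(c), Cor. 4.16] [cite: GreenbergVatsal2000, Prop. 2.8 and (10)] [cite: Kolyvagin1990, Thm. A] -/
theorem residualLambdaFormulaNegDiscAtTwo_rankZero_of_poitouTate_four (hPTb : poitouTate_selmerStructure_duality ℚ)
    (hPTa : poitouTate_sha_tateDual ℚ) (h3 : poitouTate_three_realPlaces_injective ℚ)
    (h2 : poitouTate_two_realPlaces_surjective ℚ)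
    (hGZK : Summit.BirchSwinnertonDyer.BirchSwinnertonDyer.Theses.ResidualThetaTransportAtTwo.RankEqAnalyticRankLeOne) :
    ∀ (κ : Literature.NumberTheory.EllipticCurves.ZpExtension ℚ 2) (γ : Field.absoluteGaloisGroup ℚ), κ.IsCyclotomic → κ.IsTopGenerator γ → ∀ (S₀ : Finset (IsDedekindDomain.HeightOneSpectrum (NumberField.RingOfIntegers ℚ))), (∀ v ∈ S₀, ((2 : ℕ) : NumberField.RingOfIntegers ℚ) ∉ v.asIdeal) → ∃ c : ℕ, ∀ (E : WeierstrassCurve ℚ) [E.IsElliptic] [E.IsGloballyMinimal], Literature.NumberTheory.EllipticCurves.Rank1Residual.GoodSS E 2 → E.frobeniusTrace 2 = 0 → E.Δ < 0 → E.analyticRank = 0 → (∀ v : IsDedekindDomain.HeightOneSpectrum (NumberField.RingOfIntegers ℚ), ¬ E.HasGoodReductionAt v → v ∈ S₀) → ∀ (D : Literature.NumberTheory.EllipticCurves.Kobayashi2003.SignedSelmerDualData E κ γ 1) [Module.Finite (Literature.NumberTheory.EllipticCurves.IwasawaAlgebra 2) D.X], Module.IsTorsion (Literature.NumberTheory.EllipticCurves.IwasawaAlgebra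 2) D.X → D.mu = 0 → {x : Literature.NumberTheory.EllipticCurves.subgroupH1 κ.kerSubgroup ↥(AddSubgroup.torsionBy ↥(E.geomPrimaryTorsion 2) (2 : ℤ)) | x ∈ Literature.NumberTheory.EllipticCurves.GreenbergVatsal2000.unramifiedOutside κ.kerSubgroup ↥(AddSubgroup.torsionBy ↥(E.geomPrimaryTorsion 2) (2 : ℤ)) 2 (↑S₀ : Set (IsDedekindDomain.HeightOneSpectrum (NumberField.RingOfIntegers ℚ))) ∧ (∀ (w : NumberField.InfinitePlace ℚ) (σ : Field.absoluteGaloisGroup ℚ), Literature.NumberTheory.EllipticCurves.conjH1 κ.kerSubgroup ↥(AddSubgroup.torsionBy ↥(E.geomPrimaryTorsion 2) (2 : ℤ)) σ x ∈ Literature.NumberTheory.EllipticCurves.GreenbergSelmer.infKer κ.kerSubgroup ↥(AddSubgroup.torsionBy ↥(E.geomPrimaryTorsion 2) (2 : ℤ)) w) ∧ (∀ (v : IsDedekindDomain.HeightOneSpectrum (NumberField.RingOfIntegers ℚ)), ((2 : ℕ) : NumberField.RingOfIntegers ℚ) ∈ v.asIdeal → ∀ σ : Field.absoluteGaloisGroup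 ℚ, E.conjH1 2 κ.kerSubgroup σ (Literature.NumberTheory.EllipticCurves.GreenbergVatsal2000.pushH1 κ.kerSubgroup (AddSubgroup.torsionBy ↥(E.geomPrimaryTorsion 2) (2 : ℤ)).subtype (fun _ _ ↦ rfl) x) ∈ Literature.NumberTheory.EllipticCurves.Kobayashi2003.localKummerOverOfEmb E 2 κ.kerSubgroup (Literature.NumberTheory.EllipticCurves.closureEmb (K := ℚ) (v.adicCompletion ℚ)) (⨆ n : ℕ, Literature.NumberTheory.EllipticCurves.Kobayashi2003.signedLocalPoints κ (v.adicCompletion ℚ) E 1 n))}.ncard = 2 ^ (Literature.NumberTheory.EllipticCurves.lambdaInvariant 2 D.X + ∑ v ∈ S₀, 2 ^ padicValNat 2 ((Rat.HeightOneSpectrum.natGenerator v ^ 2 - 1) / 8) * Literature.NumberTheory.EllipticCurves.GreenbergVatsal2000.dMultiplicity E 2 v + c) := by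
  intro κ γ hκ hγ S₀ hS2
  have hC : Greenberg1999.casselsSurjectivity_H1Sigma ℚ := SignedEC.CasselsPT.casselsSurjectivity_H1Sigma_of_poitouTate hPTb
  refine ⟨0, fun E _ _ hss ha hΔ hr hS D _ hX hμ ↦ ?_⟩
  have hSel : Finite (E.selmerGroupPInfty 2) :=
    Summit.BirchSwinnertonDyer.BirchSwinnertonDyer.Theorems.finite_selmerGroupPInfty_two_of_analyticRank_eq_zero E hGZK hr
  -- `Ш²(ℚ, E[2^∞]) = 0` from PT(a) + 4.10(c)₃ + 4.16 under `Sel_{2^∞}(E/ℚ)` finite (w2)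
  have hsha := SignedEC.ShaTwo.stub_shaTwoPrimaryVanishing_of_poitouTate hPTa h3 h2 E hss ha hSel
  simpa only [Nat.add_zero] using
    Summit.BirchSwinnertonDyer.BirchSwinnertonDyer.Theorems.SignedTransportAtTwo.rlf2_of_cassels_of_shaTwo hC κ γ hκ hγ
      S₀ hS2 E hss ha hΔ hS hSel hsha D hX hμ

end Summit.BirchSwinnertonDyer.BirchSwinnertonDyer.Theorems.ResidualThetaLayer

end
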